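import Mathlib
import HarnessLib

/-!
# The golden field `ℚ(√5)` has class number one

`Summits/ABC/ABC/Theorems/GoldenFieldClassNumberOne.lean` — the CHECKPOINT helper for the support
item stmt-ABC-26251 `Summit.ABC.ABC.Theses.CuspFieldPencil.GoldenFromNFPencil` (draft class-record
route `CuspFieldPencil`, LINE 17): a Lean model of the cusp field `K = ℚ(√5) = ℚ(φ)` of `X₁(5)` as
Mathlib's `QuadraticAlgebra ℚ 1 1` (`ω² = 1 + ω`, so `ω = φ = (1+√5)/2`), with

* `golden_fact` — `X² − X − 1` has no rational root (so `QuadraticAlgebra ℚ 1 1` is a field);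
* `numberField` — it is a number field;
* `trace_eq`, `discr_one_omega` — `Tr(x) = 2·re x + im x` and `disc(1, ω) = 5`;
* `abs_discr_le_five` — `|d_K| ≤ 5` (indeed `5 = [𝓞_K : ℤ[ω]]² · d_K`, by the change-of-basis
  formula for discriminants, since `1, ω` are algebraic integers);
* `ringOfIntegers_isPrincipalIdealRing` — `𝓞_K` is a PID, by Mathlib's Minkowski-bound criterion
  `RingOfIntegers.isPrincipalIdealRing_of_abs_discr_lt`: `|d_K| ≤ 5 < 9 ≤ (2·(π/4)^{r₂}·2²/2!)²`
  (using only `r₂ ≤ 1` and `π > 3`).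

No `instance`/`def` is declared: the irreducibility `Fact` is taken as an instance-implicit
hypothesis `[Fact (∀ r : ℚ, r ^ 2 ≠ 1 + 1 * r)]`, discharged by consumers with
`haveI := ⟨golden_fact⟩`.

HONESTY. Formal bookkeeping (class number one of `ℚ(√5)`, textbook) for a CLASS RECORD at abc
distance 0 (width 0); NOT abc, NOT A-PS; abc moved by 0; typed ≠ proved elsewhere.

References: Marcus, *Number Fields*, Ch. 2 (quadratic integers), Ch. 5 Cor. 2 to Thm 35
(Minkowski bound); [folklore].
-/

set_option linter.dupNamespace false

namespace Summit.ABC.ABC.Theorems.GoldenField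

open QuadraticAlgebra NumberField NumberField.InfinitePlace Module Polynomial

/-- `X² − X − 1` has no rational root: `r² ≠ 1 + r` for every `r : ℚ` (irrationality of the
golden ratio: `(2r−1)² = 5` has no rational solution). [folklore] -/
theorem golden_fact : ∀ r : ℚ, r ^ 2 ≠ (1 : ℚ) + 1 * r := by
  intro r h
  have h5 : (2 * r - 1) ^ 2 = 5 := by nlinarith [h]
  -- `5` is not the square of a rational number
  have hsq : IsSquare ((5 : ℕ) : ℚ) := ⟨2 * r - 1, by rw [← sq, h5]; norm_num⟩
  have : IsSquare (5 : ℕ) := by exact_mod_cast (Rat.isSquare_natCast_iff.mp hsq)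
  exact Nat.prime_five.prime.not_isSquare this

/-- The trace form of `QuadraticAlgebra ℚ 1 1` over `ℚ`: `Tr(x) = 2·re x + im x`
(left multiplication by `x` has matrix `[[re, im],[im, re + im]]` in the basis `1, ω`). [folklore] -/
theorem trace_eq (x : QuadraticAlgebra ℚ 1 1) :
    Algebra.trace ℚ (QuadraticAlgebra ℚ 1 1) x = 2 * x.re + x.im := by
  classical
  rw [Algebra.trace_eq_matrix_trace (QuadraticAlgebra.basis (1 : ℚ) 1) x, Matrix.trace_fin_two,
    Algebra.leftMulMatrix_eq_repr_mul, Algebra.leftMulMatrix_eq_repr_mul]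
  have h0 : (QuadraticAlgebra.basis (1 : ℚ) 1) 0 = 1 := by
    apply (QuadraticAlgebra.basis (1 : ℚ) 1).repr.injective
    ext i; fin_cases i <;> simp
  have h1 : (QuadraticAlgebra.basis (1 : ℚ) 1) 1 = ω := by
    apply (QuadraticAlgebra.basis (1 : ℚ) 1).repr.injective
    ext i; fin_cases i <;> simp
  rw [h0, h1]
  simp [QuadraticAlgebra.basis_repr_apply]
  ring

/-- The discriminant of the family `(1, ω)` of `QuadraticAlgebra ℚ 1 1` over `ℚ` is `5`
(`det [[Tr 1, Tr ω],[Tr ω, Tr ω²]] = det [[2,1],[1,3]] = 5`). [folklore] -/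
theorem discr_one_omega :
    Algebra.discr ℚ ![(1 : QuadraticAlgebra ℚ 1 1), ω] = 5 := by
  classical
  rw [Algebra.discr_def, Matrix.det_fin_two]
  simp only [Algebra.traceMatrix_apply, Algebra.traceForm_apply, trace_eq]
  simp
  norm_num

/-- `ω = φ` is an algebraic integer: it is a root of the monic polynomial `X² − X − 1 ∈ ℤ[X]`.
[folklore] -/
theorem isIntegral_omega : IsIntegral ℤ (ω : QuadraticAlgebra ℚ 1 1) := by
  refine ⟨X ^ 2 - X - 1, ?_, ?_⟩
  · have : (X ^ 2 - X - 1 : ℤ[X]) = X ^ 2 - (X + 1) := by ring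
    rw [this]
    exact (monic_X_pow 2).sub_of_left (by
      rw [degree_X_pow]
      exact (degree_X_add_C 1).trans_lt (by norm_num))
  · simp only [eval₂_sub, eval₂_X_pow, eval₂_X, eval₂_one]
    ext <;> simp [sq, omega_mul_omega_eq_mk] 

section Field

variable [Fact (∀ r : ℚ, r ^ 2 ≠ (1 : ℚ) + 1 * r)]

/-- `QuadraticAlgebra ℚ 1 1 = ℚ(√5)` is a number field. [folklore] -/
theorem numberField : NumberField (QuadraticAlgebra ℚ 1 1) :=
  NumberField.of_module_finite ℚ _

/-- `[ℚ(√5) : ℚ] = 2` (for the canonical `ℚ`-algebra structure of a characteristic-zero field).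
[folklore] -/
theorem finrank_eq_two :
    @Module.finrank ℚ (QuadraticAlgebra ℚ 1 1) _ _ (DivisionRing.toRatAlgebra).toModule = 2 := by
  convert QuadraticAlgebra.finrank_eq_two (R := ℚ) (a := (1 : ℚ)) (b := (1 : ℚ)) using 2

/-- `|d_{ℚ(√5)}| ≤ 5`: the discriminant `5` of the order `ℤ[ω]` is `[𝓞_K : ℤ[ω]]²·d_K`
(change of basis with an integer matrix, `1, ω` being algebraic integers). [folklore] -/
theorem abs_discr_le_five :
    haveI := numberField
    |NumberField.discr (QuadraticAlgebra ℚ 1 1)| ≤ 5 := by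
  haveI := numberField
  classical
  set K := QuadraticAlgebra ℚ (1 : ℚ) 1 with hK
  -- the integral basis, reindexed by `Fin 2`
  have hcard : Fintype.card (Free.ChooseBasisIndex ℤ (𝓞 K)) = Fintype.card (Fin 2) := by
    rw [← Module.finrank_eq_card_basis (RingOfIntegers.basis K), RingOfIntegers.rank,
      Fintype.card_fin]
    exact finrank_eq_two
  let e : Free.ChooseBasisIndex ℤ (𝓞 K) ≃ Fin 2 := Fintype.equivOfCardEq hcard
  let B : Basis (Fin 2) ℚ K := (integralBasis K).reindex e
  -- the family `(1, ω)` as algebraic integers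
  let w : Fin 2 → 𝓞 K := ![1, ⟨ω, isIntegral_omega⟩]
  let v : Fin 2 → K := fun i => algebraMap (𝓞 K) K (w i)
  have hv : v = ![(1 : K), ω] := by
    ext i <;> fin_cases i <;> rfl
  -- integer change-of-basis matrix
  let M : Matrix (Fin 2) (Fin 2) ℤ := fun i j => (RingOfIntegers.basis K).repr (w j) (e.symm i)
  have hP : B.toMatrix v = M.map (algebraMap ℤ ℚ) := by
    ext i j
    simp only [B, M, Basis.toMatrix_apply, Basis.repr_reindex, Finsupp.mapDomain_equiv_apply,
      Matrix.map_apply, v, integralBasis_repr_apply]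
  have hdiscr : Algebra.discr ℚ v = (M.det : ℚ) ^ 2 * (NumberField.discr K : ℚ) := by
    have h1 := Algebra.discr_of_matrix_vecMul (A := ℚ) B (B.toMatrix v)
    rw [Basis.toMatrix_map_vecMul] at h1
    rw [h1, hP, ← RingHom.mapMatrix_apply, ← RingHom.map_det, coe_discr]
    congr 1
    simp only [B, Basis.coe_reindex, Algebra.discr_reindex]
  have h5 : (5 : ℚ) = (M.det : ℚ) ^ 2 * (NumberField.discr K : ℚ) := by
    rw [← hdiscr, hv]
    convert (discr_one_omega).symm using 2
    exact Subsingleton.elim _ _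
  -- integer arithmetic: `5 = m² d` with `d ≠ 0` forces `|d| ≤ 5`
  have h5z : (5 : ℤ) = M.det ^ 2 * NumberField.discr K := by exact_mod_cast h5
  have hd : NumberField.discr K ≠ 0 := discr_ne_zero K
  have hm : M.det ≠ 0 := by
    intro h; rw [h] at h5z; norm_num at h5z
  have hm1 : 1 ≤ M.det ^ 2 := by
    have h1 : 1 ≤ |M.det| := Int.one_le_abs hm
    nlinarith [sq_abs M.det]
  calc |NumberField.discr K| = 1 * |NumberField.discr K| := by ring
    _ ≤ M.det ^ 2 * |NumberField.discr K| := by gcongr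
    _ = |M.det ^ 2 * NumberField.discr K| := by
        rw [abs_mul, abs_of_nonneg (sq_nonneg M.det)]
    _ = 5 := by rw [← h5z]; norm_num

/-- CHECKPOINT (stmt-ABC-26251): the ring of integers of the golden field `ℚ(√5)`
(`QuadraticAlgebra ℚ 1 1`) is a principal ideal domain — class number one, via the Minkowski
bound: `|d_K| ≤ 5 < 9 ≤ (2·(π/4)^{r₂}·2²/2!)²`. [folklore; Marcus, Number Fields, Ch. 5] -/
theorem ringOfIntegers_isPrincipalIdealRing :
    IsPrincipalIdealRing (𝓞 (QuadraticAlgebra ℚ 1 1)) := by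
  haveI : NumberField (QuadraticAlgebra ℚ (1 : ℚ) 1) := numberField
  apply RingOfIntegers.isPrincipalIdealRing_of_abs_discr_lt
  rw [finrank_eq_two]
  have hr : nrComplexPlaces (QuadraticAlgebra ℚ (1 : ℚ) 1) ≤ 1 := by
    have := InfinitePlace.card_add_two_mul_card_eq_rank (QuadraticAlgebra ℚ (1 : ℚ) 1)
    rw [finrank_eq_two] at this
    omega
  have hd := abs_discr_le_five
  have hdR : (|NumberField.discr (QuadraticAlgebra ℚ (1 : ℚ) 1)| : ℝ) ≤ 5 := by exact_mod_cast hd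
  have hpi : (3 / 4 : ℝ) ≤ (Real.pi / 4) ^ nrComplexPlaces (QuadraticAlgebra ℚ (1 : ℚ) 1) := by
    interval_cases h : nrComplexPlaces (QuadraticAlgebra ℚ (1 : ℚ) 1)
    · norm_num
    · rw [pow_one]; linarith [Real.pi_gt_three]
  rw [Int.cast_abs]
  calc (|(NumberField.discr (QuadraticAlgebra ℚ (1 : ℚ) 1) : ℝ)|) ≤ 5 := hdR
    _ < (2 * (3 / 4 : ℝ) * ((2 : ℕ) ^ 2 / (2 : ℕ).factorial)) ^ 2 := by norm_num [Nat.factorial]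
    _ ≤ (2 * (Real.pi / 4) ^ nrComplexPlaces (QuadraticAlgebra ℚ (1 : ℚ) 1) *
          ((2 : ℕ) ^ 2 / (2 : ℕ).factorial)) ^ 2 := by gcongr

end Field

end Summit.ABC.ABC.Theorems.GoldenField
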